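import Summits.ValiantsHypothesis.ValiantsHypothesis.Theorems.LacunarySymmetroidMatrixDescartesCensusTropicalKLawSlopes

/-!
# Route `KPlusLogSqLaw`, crux `TropicalB` — SCALE SEPARATION: the odometer reading of a dominant chain

HONEST FRAMING.  Support file toward the registered stubs `stub_tropThin` / `stub_tropFat` of the crux `TropicalB`
(ledger item `stmt-ValiantsHypothesis-19771`, route `KPlusLogSqLaw`; cell `pub-symmetroid`, seat val-sym-trop-p4, 2026-08-26;
desk ruling R1327 (4): this seat keeps the scale-separation lemma, the flip/permutation-change count is
`…TropicalPermutationChanges`).  It proves NEITHER stub and no census row: it lands STRUCTURAL lemmas about two terms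
`p ≠ q` that are unique optima at slopes `θa < θb` of one dominance design (hence about consecutive terms of every chain in
the hypothesis list of `TropicalCensus.TropRootLawAt`).  Nothing is asserted about `TropicalB` inside its window, `Lifting`,
`KPlusLogSqLaw`, `MatrixDescartes` or `VP ≠ VNP`.

CONTENTS (sorry-free; counts are written as `Finset.filter` cardinalities, no auxiliary `def`).
* `sum_d_lt_of_dominant` — the slope law `slope_lt_of_dominant` in `ℕ`: `Σᵢ d (p.2 i) < Σᵢ d (q.2 i)`.
* `countClass_le_of_dominant_top`, `countClass_top_monotone` — ONE SEPARATED CLASS: if `m·d l < d t` for every `l ≠ t`,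
  the number of columns of class `t` cannot drop from `p` to `q`, hence is monotone along every dominant alternating chain.
* `countVal_le_of_dominant_lex` — THE LEX LEMMA: if the exponent VALUES are super-increasing by the size
  (`d l < d l' ⇒ m·d l < d l'`), then for every value `D₀ = d t`: whenever `p` and `q` have the same number of columns in
  every class of exponent `> D₀`, the number of columns of exponent `D₀` does not drop.  I.e. the vector
  (number of columns of exponent `D`)_{D decreasing} increases LEXICOGRAPHICALLY along the chain — the chain is an odometer
  whose digits are the exponent values; `countVal_top_monotone` is the top digit along a chain.
* arithmetic helpers `sum_d_split3`, `sum_above_eq_of_countClass`, `sum_below_bound`.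

WHY (docstring only).  Slope counting bounds a chain by the NUMBER of odometer states (`C(m+K−1, m)`); every finer analysis of
the window — Gusfield-type recursions on the heavy digit, «carries are expensive» arguments, or lower-bound register
gadgets — first needs the reading that the state moves lexicographically and that within a run of the top digits the lower
digits form a dominant chain of the same design.  The lemma is exact for super-increasing exponents (the lacunary extreme,
where all `C(m+K−1,m)` slopes are distinct); for general exponents only the total slope is monotone.

[folklore] (exchange/convexity argument: add the two strict optimality inequalities).
-/

-- `Summit.ValiantsHypothesis.ValiantsHypothesis.…` repeats a component by the D-0017 layout
-- (single-conjunct summit), which the `dupNamespace` linter flags; the name is mandated.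
set_option linter.dupNamespace false
set_option autoImplicit false

namespace Summit.ValiantsHypothesis.ValiantsHypothesis.Theorems.LacunarySymmetroidMatrixDescartes.TropicalCensus

open Summit.ValiantsHypothesis.ValiantsHypothesis.Theorems.MatrixDescartes.Negative
open Finset

section ScaleSeparation

variable {m K : ℕ}

/-! ## 1. The slope law in `ℕ` and a three-way split of the slope -/

/-- The slope law in natural numbers: between the unique optima `p` at `θa` and `q ≠ p` at `θb > θa` the total exponent
strictly increases, `Σᵢ d (p.2 i) < Σᵢ d (q.2 i)` (`slope_lt_of_dominant`, uncast). [folklore] -/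
theorem sum_d_lt_of_dominant (d : Fin K → ℕ) (v ε : Fin m → Fin m → Fin K → ℤ) {θa θb : ℤ} (hab : θa < θb)
    {p q : Equiv.Perm (Fin m) × (Fin m → Fin K)} (hne : p ≠ q) (ha : IsDominant d v ε θa p)
    (hb : IsDominant d v ε θb q) : ∑ i, d (p.2 i) < ∑ i, d (q.2 i) := by
  have h := slope_lt_of_dominant d v ε hab hne ha hb
  unfold slope at h
  exact_mod_cast h

/-- three-way split of `Σᵢ d (r i)` at a threshold value `D₀`: exponents above, equal to (`D₀ · #`), and below `D₀`. [folklore] -/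
theorem sum_d_split3 (d : Fin K → ℕ) (r : Fin m → Fin K) (D₀ : ℕ) :
    ∑ i, d (r i) = ∑ i ∈ univ.filter (fun i => D₀ < d (r i)), d (r i) +
      D₀ * (univ.filter fun i => d (r i) = D₀).card + ∑ i ∈ univ.filter (fun i => d (r i) < D₀), d (r i) := by
  rw [← sum_filter_add_sum_filter_not univ (fun i => D₀ < d (r i))]
  rw [add_assoc]
  congr 1
  rw [← sum_filter_add_sum_filter_not (univ.filter fun i => ¬ D₀ < d (r i)) (fun i => d (r i) = D₀)]
  rw [filter_filter, filter_filter]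
  congr 1
  · rw [sum_congr rfl (fun i hi => ((mem_filter.mp hi).2.2 : d (r i) = D₀)), sum_const, smul_eq_mul, mul_comm]
    congr 2
    ext i
    simp only [mem_filter, mem_univ, true_and]
    constructor
    · exact fun h => h.2
    · intro h; exact ⟨by omega, h⟩
  · apply sum_congr _ (fun _ _ => rfl)
    ext i
    simp only [mem_filter, mem_univ, true_and]
    omega

/-- the part of the slope above `D₀` only depends on the class counts of the classes of exponent `> D₀`. [folklore] -/
theorem sum_above_eq_of_countClass (d : Fin K → ℕ) (r r' : Fin m → Fin K) (D₀ : ℕ)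
    (hagree : ∀ l : Fin K, D₀ < d l → (univ.filter fun i => r i = l).card = (univ.filter fun i => r' i = l).card) :
    ∑ i ∈ univ.filter (fun i => D₀ < d (r i)), d (r i) = ∑ i ∈ univ.filter (fun i => D₀ < d (r' i)), d (r' i) := by
  -- regroup both sums by class
  have key : ∀ s : Fin m → Fin K, ∑ i ∈ univ.filter (fun i => D₀ < d (s i)), d (s i) =
      ∑ l : Fin K, (if D₀ < d l then (univ.filter fun i => s i = l).card * d l else 0) := by
    intro s
    rw [← sum_fiberwise (univ.filter fun i => D₀ < d (s i)) s (fun i => d (s i))]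
    refine sum_congr rfl fun l _ => ?_
    split_ifs with h
    · rw [filter_filter, sum_congr rfl (fun i hi => by rw [(mem_filter.mp hi).2.2] : ∀ i ∈ univ.filter
        (fun i => D₀ < d (s i) ∧ s i = l), d (s i) = d l), sum_const, smul_eq_mul]
      congr 2
      ext i
      simp only [mem_filter, mem_univ, true_and]
      constructor
      · exact fun hh => hh.2
      · intro hh; exact ⟨hh ▸ h, hh⟩
    · apply sum_eq_zero
      intro i hi
      rw [mem_filter, mem_filter] at hi
      exact absurd (hi.2 ▸ hi.1.2) h
  rw [key r, key r']
  refine sum_congr rfl fun l _ => ?_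
  split_ifs with h
  · rw [hagree l h]
  · rfl

/-- the part of the slope below `D₀ = d t` is small under super-increasing values: each summand `e` has `m·e + 1 ≤ D₀`, so
`m · (below part) + #(below) ≤ #(below) · D₀`. [folklore] -/
theorem sum_below_bound (d : Fin K → ℕ) (hsup : ∀ l l' : Fin K, d l < d l' → m * d l < d l') (r : Fin m → Fin K)
    (t : Fin K) :
    m * ∑ i ∈ univ.filter (fun i => d (r i) < d t), d (r i) + (univ.filter fun i => d (r i) < d t).card ≤
      (univ.filter fun i => d (r i) < d t).card * d t := by
  rw [mul_sum, card_eq_sum_ones, sum_mul, ← sum_add_distrib]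
  refine sum_le_sum fun i hi => ?_
  have := hsup (r i) t (mem_filter.mp hi).2
  omega

/-! ## 2. One separated class: the top digit -/

/-- **Scale separation, one class.**  If class `t` outweighs every other class by the size (`m·d l < d t` for `l ≠ t`),
then between the unique optima `p` at `θa` and `q ≠ p` at `θb > θa` the number of class-`t` columns cannot drop:
otherwise `slope q ≤ (c−1)·d t + (light part < d t) < c·d t ≤ slope p`, against the slope law. [folklore] -/
theorem countClass_le_of_dominant_top (d : Fin K → ℕ) (v ε : Fin m → Fin m → Fin K → ℤ) {θa θb : ℤ}
    (hab : θa < θb) {p q : Equiv.Perm (Fin m) × (Fin m → Fin K)} (hne : p ≠ q) (ha : IsDominant d v ε θa p)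
    (hb : IsDominant d v ε θb q) (t : Fin K) (ht : ∀ l, l ≠ t → m * d l < d t) :
    (univ.filter fun i => p.2 i = t).card ≤ (univ.filter fun i => q.2 i = t).card := by
  by_contra hcon
  push Not at hcon
  have hslope := sum_d_lt_of_dominant d v ε hab hne ha hb
  -- split both slopes into class-`t` columns and the rest
  have hsplit : ∀ r : Fin m → Fin K, ∑ i, d (r i) =
      (univ.filter fun i => r i = t).card * d t + ∑ i ∈ univ.filter (fun i => r i ≠ t), d (r i) := by
    intro r
    rw [← sum_filter_add_sum_filter_not univ (fun i => r i = t)]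
    congr 1
    rw [sum_congr rfl (fun i hi => by rw [(mem_filter.mp hi).2] : ∀ i ∈ univ.filter (fun i => r i = t),
      d (r i) = d t), sum_const, smul_eq_mul]
  rw [hsplit p.2, hsplit q.2] at hslope
  -- light part of `q`: `m · light ≤ #light · (d t − 1) ≤ m · d t − #light`
  have hlight : m * ∑ i ∈ univ.filter (fun i => q.2 i ≠ t), d (q.2 i) + (univ.filter fun i => q.2 i ≠ t).card ≤
      (univ.filter fun i => q.2 i ≠ t).card * d t := by
    rw [mul_sum, card_eq_sum_ones, sum_mul, ← sum_add_distrib]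
    refine sum_le_sum fun i hi => ?_
    have := ht (q.2 i) (mem_filter.mp hi).2
    omega
  have hcard : (univ.filter fun i => q.2 i ≠ t).card ≤ m := by
    have := card_le_univ (univ.filter fun i => q.2 i ≠ t)
    rwa [Fintype.card_fin] at this
  rcases Nat.eq_zero_or_pos m with hm | hm
  · subst hm
    have h0 : (univ.filter fun i => p.2 i = t).card = 0 := by simp
    omega
  -- multiply the slope inequality by `m` and compare
  have h1 : m * ((univ.filter fun i => p.2 i = t).card * d t) <
      m * ((univ.filter fun i => q.2 i = t).card * d t) + m * ∑ i ∈ univ.filter (fun i => q.2 i ≠ t), d (q.2 i) := by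
    have := Nat.mul_lt_mul_of_pos_left hslope hm
    rw [Nat.mul_add, Nat.mul_add] at this
    omega
  have h2 : m * ∑ i ∈ univ.filter (fun i => q.2 i ≠ t), d (q.2 i) ≤ m * d t := by
    have := Nat.mul_le_mul_right (d t) hcard
    omega
  have h3 : m * ((univ.filter fun i => q.2 i = t).card * d t) + m * d t ≤
      m * ((univ.filter fun i => p.2 i = t).card * d t) := by
    rw [← Nat.mul_add, ← Nat.succ_mul]
    exact Nat.mul_le_mul_left _ (Nat.mul_le_mul_right _ hcon)
  omega

/-- **The top digit is monotone along a chain.**  Under the same separation hypothesis the class-`t` count is monotone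
along every dominant sign-alternating chain (hypothesis list of `TropRootLawAt`). [folklore] -/
theorem countClass_top_monotone (d : Fin K → ℕ) (v ε : Fin m → Fin m → Fin K → ℤ) {n : ℕ} (θ : Fin (n + 1) → ℤ)
    (p : Fin (n + 1) → Equiv.Perm (Fin m) × (Fin m → Fin K)) (hθ : StrictMono θ)
    (hdom : ∀ k, IsDominant d v ε (θ k) (p k))
    (halt : ∀ k : Fin n, termSign ε (p k.castSucc) * termSign ε (p k.succ) < 0)
    (t : Fin K) (ht : ∀ l, l ≠ t → m * d l < d t) :
    Monotone fun k => (univ.filter fun i => (p k).2 i = t).card := by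
  refine Fin.monotone_iff_le_succ.mpr fun k => ?_
  have hne : p k.castSucc ≠ p k.succ := by
    intro h
    have := halt k
    rw [h] at this
    exact absurd this (not_lt.mpr (mul_self_nonneg _))
  exact countClass_le_of_dominant_top d v ε (hθ Fin.castSucc_lt_succ) hne (hdom _) (hdom _) t ht

/-! ## 3. Super-increasing exponent values: the lexicographic law -/

/-- **THE LEX LEMMA.**  Suppose the exponent values are super-increasing by the size: `d l < d l' ⇒ m·d l < d l'`.  Let `p`
be the unique optimum at `θa` and `q ≠ p` the unique optimum at `θb > θa`, and let `D₀ = d t` be an exponent value such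
that `p` and `q` have equally many columns in every class of exponent `> D₀`.  Then the number of columns of exponent `D₀`
does not drop from `p` to `q`.  (So the first value, from the top, at which the exponent profiles of `p` and `q` differ
sees an INCREASE: the profile moves lexicographically — the odometer law.)  Proof: split both slopes at `D₀`; the parts
above agree (`sum_above_eq_of_countClass`), the part of `q` below is `< D₀` (`sum_below_bound`), and the slope law gives
`D₀·c_p ≤ D₀·c_p + below_p < D₀·c_q + below_q < D₀·(c_q + 1)`. [folklore] -/
theorem countVal_le_of_dominant_lex (d : Fin K → ℕ) (hsup : ∀ l l' : Fin K, d l < d l' → m * d l < d l')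
    (v ε : Fin m → Fin m → Fin K → ℤ) {θa θb : ℤ} (hab : θa < θb) {p q : Equiv.Perm (Fin m) × (Fin m → Fin K)}
    (hne : p ≠ q) (ha : IsDominant d v ε θa p) (hb : IsDominant d v ε θb q) (t : Fin K)
    (hagree : ∀ l : Fin K, d t < d l →
      (univ.filter fun i => p.2 i = l).card = (univ.filter fun i => q.2 i = l).card) :
    (univ.filter fun i => d (p.2 i) = d t).card ≤ (univ.filter fun i => d (q.2 i) = d t).card := by
  set D₀ := d t with hD₀
  by_contra hcon
  push Not at hcon
  have hslope := sum_d_lt_of_dominant d v ε hab hne ha hb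
  rw [sum_d_split3 d p.2 D₀, sum_d_split3 d q.2 D₀, sum_above_eq_of_countClass d p.2 q.2 D₀ hagree] at hslope
  -- names
  set cp := (univ.filter fun i => d (p.2 i) = D₀).card
  set cq := (univ.filter fun i => d (q.2 i) = D₀).card
  set Bp := ∑ i ∈ univ.filter (fun i => d (p.2 i) < D₀), d (p.2 i)
  set Bq := ∑ i ∈ univ.filter (fun i => d (q.2 i) < D₀), d (q.2 i)
  set nb := (univ.filter fun i => d (q.2 i) < D₀).card
  -- the slope law now reads `D₀·cp + Bp < D₀·cq + Bq`
  have h1 : D₀ * cp + Bp < D₀ * cq + Bq := by omega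
  have hbelow : m * Bq + nb ≤ nb * D₀ := sum_below_bound d hsup q.2 t
  have hnb : nb ≤ m := by
    have := card_le_univ (univ.filter fun i => d (q.2 i) < D₀)
    rwa [Fintype.card_fin] at this
  rcases Nat.eq_zero_or_pos m with hm | hm
  · subst hm
    have h0 : cp = 0 := by simp [cp]
    omega
  -- `m · Bq < m · D₀` unless there is no column below, in which case `Bq = 0`
  rcases Nat.eq_zero_or_pos nb with hnb0 | hnb0
  · have hBq : Bq = 0 := by
      have : (univ.filter fun i => d (q.2 i) < D₀) = ∅ := card_eq_zero.mp hnb0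
      simp only [Bq, this, sum_empty]
    -- then `D₀ cp ≤ D₀ cp + Bp < D₀ cq`, so `cp < cq`
    have : D₀ * cp < D₀ * cq := by omega
    have := Nat.lt_of_mul_lt_mul_left this
    omega
  · have h2 : m * Bq < m * D₀ := by
      have := Nat.mul_le_mul_right D₀ hnb
      omega
    -- multiply `h1` by `m`: `m D₀ cp ≤ m D₀ cp + m Bp < m D₀ cq + m Bq < m D₀ cq + m D₀ = m D₀ (cq + 1) ≤ m D₀ cp`
    have h3 : m * (D₀ * cp) < m * (D₀ * cq) + m * D₀ := by
      have := Nat.mul_lt_mul_of_pos_left h1 hm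
      rw [Nat.mul_add, Nat.mul_add] at this
      omega
    have h4 : m * (D₀ * cq) + m * D₀ ≤ m * (D₀ * cp) := by
      rw [← Nat.mul_add, ← Nat.mul_succ]
      exact Nat.mul_le_mul_left _ (Nat.mul_le_mul_left _ hcon)
    omega

/-- **The top digit, value form, along a chain.**  Under super-increasing values the number of columns carrying the LARGEST
exponent value `d t` (`d l ≤ d t` for all `l`) is monotone along every dominant sign-alternating chain (the hypothesis of
the lex lemma about larger classes is vacuous). [folklore] -/
theorem countVal_top_monotone (d : Fin K → ℕ) (hsup : ∀ l l' : Fin K, d l < d l' → m * d l < d l')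
    (v ε : Fin m → Fin m → Fin K → ℤ) {n : ℕ} (θ : Fin (n + 1) → ℤ)
    (p : Fin (n + 1) → Equiv.Perm (Fin m) × (Fin m → Fin K)) (hθ : StrictMono θ)
    (hdom : ∀ k, IsDominant d v ε (θ k) (p k))
    (halt : ∀ k : Fin n, termSign ε (p k.castSucc) * termSign ε (p k.succ) < 0)
    (t : Fin K) (htop : ∀ l, d l ≤ d t) :
    Monotone fun k => (univ.filter fun i => d ((p k).2 i) = d t).card := by
  refine Fin.monotone_iff_le_succ.mpr fun k => ?_
  have hne : p k.castSucc ≠ p k.succ := by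
    intro h
    have := halt k
    rw [h] at this
    exact absurd this (not_lt.mpr (mul_self_nonneg _))
  exact countVal_le_of_dominant_lex d hsup v ε (hθ Fin.castSucc_lt_succ) hne (hdom _) (hdom _) t
    (fun l hl => absurd hl (not_lt.mpr (htop l)))

end ScaleSeparation

end Summit.ValiantsHypothesis.ValiantsHypothesis.Theorems.LacunarySymmetroidMatrixDescartes.TropicalCensus
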